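import Mathlib.AlgebraicGeometry.Morphisms.Separated
import Mathlib.AlgebraicGeometry.Morphisms.Proper
import Mathlib.AlgebraicGeometry.Morphisms.Smooth
import Mathlib.AlgebraicGeometry.Morphisms.FiniteType
import Mathlib.CategoryTheory.Comma.Over.Pullback
import Mathlib.CategoryTheory.Endomorphism
import Mathlib.CategoryTheory.MorphismProperty.Limits
import HarnessLib

/-!
# Fixed-point schemes of group actions; equivariant smooth proper families

Literature topic `AlgebraicGeometry/GroupActions` (items `defn-FixedPointScheme` = D1 and
`defn-EquivariantSmoothProperFamily` = D2 of the Kum⁴ cell, consumer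
`Summit.Ventures.HodgeKum4.Kum4FixedFourfoldMeetsTranslates`).

## Fixed-point (invariant) subscheme — the interface (D1)

For a group `G` acting on an object `Y` of a category through `ρ : G →* Aut Y`
(for `k`-schemes: `Y : SchemeOver k = Over (Spec k)`; over a base: `Y : Over S`), a morphism
`j : F ⟶ Y` *exhibits `F` as the fixed-point object* (`IsFixedPointObject ρ j`) when `j` is
`ρ`-invariant and every `ρ`-invariant `T`-point `y : T ⟶ Y` factors uniquely through `j`, i.e.
`F` represents the invariant-locus functor `T ↦ {y ∈ Y(T) | ρ(g) ∘ y = y for all g}` of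
Conrad–Gabber–Prasad, *Pseudo-reductive groups*, Prop. A.8.10(1)
[corpus: book:conrad2010-pseudo-reductive-groups p0649, read 2026-08-26].  For `S`-schemes
`IsFixedPointScheme ρ j` adds that `j` is a closed immersion (Mathlib `IsClosedImmersion j.left`).
Existence is NOT part of the interface.

API (all proved): uniqueness of factorisations (`hom_ext`, `mono`), the factorisation `lift`,
the functor-of-points bijection `homEquiv : (T ⟶ F) ≃ {y : T ⟶ Y // invariant}`, uniqueness up
to isomorphism (`iso`), transport along isomorphisms, preservation by right adjoints (`map`) and
hence **compatibility with base change** `Over.pullback f` (`IsFixedPointScheme.baseChange`,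
`IsFixedPointScheme.fibre`), permanence of `LocallyOfFiniteType` / `IsSeparated` / `IsProper`
for `F → S`.

## Construction / representability for finite groups (CGP A.8.10(1), finite case)

For a FINITE group and `Y → S` separated, the invariant-locus functor is represented by the
closed subscheme obtained by iterating equalizers `Eq(ι ≫ ρ g, ι)` over the elements of `G`
(`commonFixedLocus`, `fixedPointScheme ρ`, `fixedPointScheme.ι ρ`); closedness of each equalizer
is Görtz–Wedhorn I, Def./Prop. 9.7(ii) [corpus: book:gortz2020-algebraic-geometry-i-schemes-2nd-ed
p0286] = Mathlib `isClosedImmersion_equalizer_ι_left`.  `fixedPointScheme.isFixedPointScheme` is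
the representability statement of CGP A.8.10(1) in the finite-group case (the printed generality —
an affine flat `k`-group scheme with projective coordinate ring — is
`TODO(general form)`); the tangent-space and smoothness clauses of A.8.10(1)–(2) are the separate
cite items filed with D1/D2 and are not stated here.

## Equivariant smooth proper families (D2)

`IsEquivariantSmoothProperFamily π ρ` for `π : 𝒳 ⟶ B` and `ρ : G →* Aut 𝒳`: `π` is smooth
(Mathlib `Smooth`) and proper (`IsProper`) and the action is by `B`-automorphisms,
`(ρ g).hom ≫ π = π` — the algebraic form of the equivariant proper families of
Hassett–Tschinkel, *Hodge theory and Lagrangian planes on generalized Kummer fourfolds*, §2,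
Thm. 2.1 [corpus: paper:arxiv-1004.0046 p0003].  `overAction` turns such a `ρ` into
`G →* Aut (Over.mk π)`, so D1 applies in `Over B`: the relative fixed-point scheme
`h.fixedPointScheme : Over B` (finite `G`) with `IsFixedPointScheme`, proper over `B`; its fibres
are the fixed-point schemes of the fibre actions by `IsFixedPointScheme.baseChange`.  Finiteness of
`G`, connectedness of `B` and invertibility of `|G|` on `B` (`OrderInvertibleOn G B`) are
hypotheses of the USES, not fields of the structure.  The existence of such a family through a
given fibre is never asserted here (it is a separate printed input of the consumer).

No instances, no notation, no `sorry`; no named facts (every `Prop` here has explicit binders and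
every theorem is proved).

## References

* B. Conrad, O. Gabber, G. Prasad, *Pseudo-reductive groups*, 2nd ed., CUP 2015, Prop. A.8.10.
* U. Görtz, T. Wedhorn, *Algebraic Geometry I*, 2nd ed., 2020, Def./Prop. 9.7, (9.2).
* B. Hassett, Y. Tschinkel, Moscow Math. J. 13 (2013), §2 Thm. 2.1.
* J. Fogarty, *Fixed point schemes*, Amer. J. Math. 95 (1973) 35–51 (classical source of the
  notion; not used for any statement here).
-/

universe u

open CategoryTheory CategoryTheory.Limits AlgebraicGeometry

namespace Literature.AlgebraicGeometry.GroupActions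

/-! ## Fixed-point objects of an action by automorphisms (any category) -/

section Category

variable {C : Type*} [Category C] {G : Type*} [Group G]

/-- For a group `G` acting on `Y` through `ρ : G →* Aut Y`, the morphism `j : F ⟶ Y` **exhibits
`F` as the fixed-point (invariant) object** of the action: `j` is `ρ`-invariant
(`j ≫ ρ g = j`) and every `ρ`-invariant generalized point `y : T ⟶ Y` factors UNIQUELY
through `j` — i.e. `F` represents the invariant-locus sub-functor
`T ↦ {y ∈ Y(T) | ρ(g) ∘ y = y ∀ g}` of the functor of points of `Y`.  This is the functorial
definition of the invariant locus of [cite: ConradGabberPrasad2015, Prop. A.8.10(1)], stated in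
an arbitrary category (existence is not part of the predicate). -/
structure IsFixedPointObject {Y F : C} (ρ : G →* Aut Y) (j : F ⟶ Y) : Prop where
  /-- `j` is invariant: `j ≫ ρ g = j` for every `g`. -/
  comp_hom : ∀ g : G, j ≫ (ρ g).hom = j
  /-- Universality: every invariant `T`-point of `Y` factors uniquely through `j`. -/
  existsUnique_fac : ∀ ⦃T : C⦄ (y : T ⟶ Y), (∀ g : G, y ≫ (ρ g).hom = y) →
    ∃! t : T ⟶ F, t ≫ j = y

namespace IsFixedPointObject

variable {Y F T : C} {ρ : G →* Aut Y} {j : F ⟶ Y}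

/-- Two morphisms into a fixed-point object agree if they agree after `j`
[cite: ConradGabberPrasad2015, Prop. A.8.10(1)]. -/
theorem hom_ext (h : IsFixedPointObject ρ j) {t₁ t₂ : T ⟶ F} (e : t₁ ≫ j = t₂ ≫ j) :
    t₁ = t₂ := by
  have hy : ∀ g : G, (t₂ ≫ j) ≫ (ρ g).hom = t₂ ≫ j := fun g => by
    rw [Category.assoc, h.comp_hom]
  exact (h.existsUnique_fac (t₂ ≫ j) hy).unique e rfl

/-- The structure map of a fixed-point object is a monomorphism
[cite: ConradGabberPrasad2015, Prop. A.8.10(1)]. -/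
theorem mono (h : IsFixedPointObject ρ j) : Mono j :=
  ⟨fun _ _ e => h.hom_ext e⟩

/-- The factorisation of an invariant `T`-point `y` of `Y` through the fixed-point object
[cite: ConradGabberPrasad2015, Prop. A.8.10(1)]. -/
noncomputable def lift (h : IsFixedPointObject ρ j) (y : T ⟶ Y)
    (hy : ∀ g : G, y ≫ (ρ g).hom = y) : T ⟶ F :=
  (h.existsUnique_fac y hy).exists.choose

/-- [cite: ConradGabberPrasad2015, Prop. A.8.10(1)] -/
@[simp]
theorem lift_comp (h : IsFixedPointObject ρ j) (y : T ⟶ Y) (hy : ∀ g : G, y ≫ (ρ g).hom = y) :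
    h.lift y hy ≫ j = y :=
  (h.existsUnique_fac y hy).exists.choose_spec

/-- [cite: ConradGabberPrasad2015, Prop. A.8.10(1)] -/
theorem eq_lift (h : IsFixedPointObject ρ j) {y : T ⟶ Y} (hy : ∀ g : G, y ≫ (ρ g).hom = y)
    {t : T ⟶ F} (ht : t ≫ j = y) : t = h.lift y hy :=
  h.hom_ext (by rw [ht, lift_comp])

/-- **Functor of points** of a fixed-point object: `T`-points of `F` are exactly the
`ρ`-invariant `T`-points of `Y` [cite: ConradGabberPrasad2015, Prop. A.8.10(1)]. -/
noncomputable def homEquiv (h : IsFixedPointObject ρ j) (T : C) :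
    (T ⟶ F) ≃ {y : T ⟶ Y // ∀ g : G, y ≫ (ρ g).hom = y} where
  toFun t := ⟨t ≫ j, fun g => by rw [Category.assoc, h.comp_hom]⟩
  invFun y := h.lift y.1 y.2
  left_inv t := (h.eq_lift _ rfl).symm
  right_inv y := Subtype.ext (h.lift_comp y.1 y.2)

/-- [cite: ConradGabberPrasad2015, Prop. A.8.10(1)] -/
@[simp]
theorem homEquiv_apply_coe (h : IsFixedPointObject ρ j) (t : T ⟶ F) :
    ((h.homEquiv T) t : T ⟶ Y) = t ≫ j := rfl

/-- [cite: ConradGabberPrasad2015, Prop. A.8.10(1)] -/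
@[simp]
theorem homEquiv_symm_apply_comp (h : IsFixedPointObject ρ j)
    (y : {y : T ⟶ Y // ∀ g : G, y ≫ (ρ g).hom = y}) :
    (h.homEquiv T).symm y ≫ j = y :=
  h.lift_comp y.1 y.2

/-- For the TRIVIAL action the identity exhibits `Y` as its own fixed-point object
(`Y^G = Y`) [cite: ConradGabberPrasad2015, Prop. A.8.10(1)]. -/
theorem id_of_trivial (Y : C) : IsFixedPointObject (1 : G →* Aut Y) (𝟙 Y) where
  comp_hom g := by rw [MonoidHom.one_apply]; exact Category.comp_id _
  existsUnique_fac T y _ := ⟨y, Category.comp_id y, fun t ht => by simpa using ht⟩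

/-- Transport of the fixed-point property along an isomorphism of the source
[cite: ConradGabberPrasad2015, Prop. A.8.10(1)]. -/
theorem of_iso (h : IsFixedPointObject ρ j) {F' : C} (e : F' ≅ F) :
    IsFixedPointObject ρ (e.hom ≫ j) where
  comp_hom g := by rw [Category.assoc, h.comp_hom]
  existsUnique_fac T y hy := by
    refine ⟨h.lift y hy ≫ e.inv, by simp, fun t ht => ?_⟩
    have ht' : t ≫ e.hom = h.lift y hy := h.eq_lift hy (by rw [Category.assoc]; exact ht)
    rw [← ht', Category.assoc, e.hom_inv_id, Category.comp_id]

section Unique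

variable {F₁ F₂ : C} {j₁ : F₁ ⟶ Y} {j₂ : F₂ ⟶ Y}

/-- Two fixed-point objects of the same action are canonically isomorphic (uniqueness of the
representing object) [cite: ConradGabberPrasad2015, Prop. A.8.10(1)]. -/
noncomputable def iso (h₁ : IsFixedPointObject ρ j₁) (h₂ : IsFixedPointObject ρ j₂) :
    F₁ ≅ F₂ where
  hom := h₂.lift j₁ h₁.comp_hom
  inv := h₁.lift j₂ h₂.comp_hom
  hom_inv_id := h₁.hom_ext (by simp)
  inv_hom_id := h₂.hom_ext (by simp)

/-- [cite: ConradGabberPrasad2015, Prop. A.8.10(1)] -/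
@[simp]
theorem iso_hom_comp (h₁ : IsFixedPointObject ρ j₁) (h₂ : IsFixedPointObject ρ j₂) :
    (h₁.iso h₂).hom ≫ j₂ = j₁ :=
  h₂.lift_comp j₁ h₁.comp_hom

/-- [cite: ConradGabberPrasad2015, Prop. A.8.10(1)] -/
@[simp]
theorem iso_inv_comp (h₁ : IsFixedPointObject ρ j₁) (h₂ : IsFixedPointObject ρ j₂) :
    (h₁.iso h₂).inv ≫ j₁ = j₂ :=
  h₁.lift_comp j₂ h₂.comp_hom

end Unique

/-- The action transported along a functor `R`: `g ↦ R.mapIso (ρ g)`; on morphisms this is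
`R.map (ρ g).hom` [cite: ConradGabberPrasad2015, Prop. A.8.10(1)]. -/
theorem mapAut_comp_apply_hom {D : Type*} [Category D] (R : C ⥤ D) (ρ : G →* Aut Y) (g : G) :
    (((R.mapAut Y).comp ρ) g).hom = R.map (ρ g).hom := rfl

/-- **Right adjoints preserve fixed-point objects**: if `j : F ⟶ Y` is a fixed-point object for
`ρ` and `R` is a right adjoint, then `R.map j` is a fixed-point object for the transported action
`g ↦ R.mapIso (ρ g)`.  Applied to `R = Over.pullback f` this is the compatibility of the
invariant locus with base change [cite: ConradGabberPrasad2015, Prop. A.8.10(1)]. -/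
theorem map (h : IsFixedPointObject ρ j) {D : Type*} [Category D] {L : D ⥤ C} {R : C ⥤ D}
    (adj : L ⊣ R) : IsFixedPointObject ((R.mapAut Y).comp ρ) (R.map j) where
  comp_hom g := by rw [mapAut_comp_apply_hom, ← R.map_comp, h.comp_hom]
  existsUnique_fac T y hy := by
    have hy' : ∀ g : G, (adj.homEquiv _ _).symm y ≫ (ρ g).hom = (adj.homEquiv _ _).symm y :=
      fun g => by rw [← Adjunction.homEquiv_naturality_right_symm, ← mapAut_comp_apply_hom R ρ,
        hy g]
    refine ⟨adj.homEquiv _ _ (h.lift _ hy'), ?_, fun t ht => ?_⟩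
    · dsimp only
      rw [← Adjunction.homEquiv_naturality_right, lift_comp, Equiv.apply_symm_apply]
    · dsimp only at ht
      apply (adj.homEquiv _ _).symm.injective
      rw [Equiv.symm_apply_apply]
      exact h.eq_lift hy' (by rw [← Adjunction.homEquiv_naturality_right_symm, ht])

end IsFixedPointObject

end Category

/-! ## Fixed-point schemes over a base -/

section Scheme

variable {S : Scheme.{u}} {G : Type*} [Group G]

/-- **Fixed-point (invariant) subscheme** — the interface.  For a group `G` acting on an
`S`-scheme `Y : Over S` by `S`-automorphisms `ρ : G →* Aut Y` (for `k`-schemes take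
`S = Spec k`, i.e. `Y : SchemeOver k`), `j : F ⟶ Y` exhibits `F` as the fixed-point scheme
`Y^G`: `j` is a CLOSED IMMERSION, `j` is `ρ`-invariant, and every invariant `T`-point of `Y`
factors uniquely through `j` (`F` represents the invariant-locus functor).  Existence is not part
of the predicate; for finite `G` and `Y → S` separated it is `fixedPointScheme.isFixedPointScheme`
below [cite: ConradGabberPrasad2015, Prop. A.8.10(1)]. -/
structure IsFixedPointScheme {Y F : Over S} (ρ : G →* Aut Y) (j : F ⟶ Y) : Prop
    extends IsFixedPointObject ρ j where
  /-- the fixed-point scheme is a closed subscheme. -/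
  isClosedImmersion : IsClosedImmersion j.left

namespace IsFixedPointScheme

variable {Y F : Over S} {ρ : G →* Aut Y} {j : F ⟶ Y}

/-- `Y^G` is locally of finite type over `S` if `Y` is
[cite: ConradGabberPrasad2015, Prop. A.8.10(1)]. -/
theorem locallyOfFiniteType (h : IsFixedPointScheme ρ j) [LocallyOfFiniteType Y.hom] :
    LocallyOfFiniteType F.hom := by
  have := h.isClosedImmersion
  rw [← Over.w j]
  infer_instance

/-- `Y^G → S` is separated if `Y → S` is (closed immersions are separated)
[cite: GortzWedhorn2020, Def./Prop. 9.7 and Rem. 9.11]. -/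
theorem isSeparated (h : IsFixedPointScheme ρ j) [IsSeparated Y.hom] : IsSeparated F.hom := by
  have := h.isClosedImmersion
  rw [← Over.w j]
  infer_instance

/-- `Y^G → S` is proper if `Y → S` is (a closed subscheme of a proper scheme is proper)
[cite: GortzWedhorn2020, Rem. 9.11]. -/
theorem isProper (h : IsFixedPointScheme ρ j) [IsProper Y.hom] : IsProper F.hom := by
  have := h.isClosedImmersion
  rw [← Over.w j]
  infer_instance

/-- **The fixed-point scheme commutes with base change.**  If `j : F ⟶ Y` is the fixed-point
scheme of `ρ` over `S` and `f : S' ⟶ S`, then `F ×_S S' ⟶ Y ×_S S'` (`(Over.pullback f).map j`)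
is the fixed-point scheme of the base-changed action `g ↦ (Over.pullback f).mapIso (ρ g)` over
`S'` — the functor-of-points definition is stable under restriction to `S'`-schemes, and closed
immersions are stable under base change [cite: ConradGabberPrasad2015, Prop. A.8.10(1)]. -/
theorem baseChange (h : IsFixedPointScheme ρ j) {S' : Scheme.{u}} (f : S' ⟶ S) :
    IsFixedPointScheme (((Over.pullback f).mapAut Y).comp ρ) ((Over.pullback f).map j) where
  toIsFixedPointObject := h.toIsFixedPointObject.map (Over.mapPullbackAdj f)
  isClosedImmersion :=
    MorphismProperty.overPullbackMap (P := @IsClosedImmersion) f j h.isClosedImmersion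

/-- The FIBRE of the fixed-point scheme at `s ∈ S` is the fixed-point scheme of the action on the
fibre `Y_s` (base change along `Spec κ(s) ⟶ S`) [cite: ConradGabberPrasad2015, Prop. A.8.10(1)]. -/
theorem fibre (h : IsFixedPointScheme ρ j) (s : S) :
    IsFixedPointScheme (((Over.pullback (S.fromSpecResidueField s)).mapAut Y).comp ρ)
      ((Over.pullback (S.fromSpecResidueField s)).map j) :=
  h.baseChange _

/-- For the trivial action, `𝟙 Y` exhibits `Y` as its own fixed-point scheme
[cite: ConradGabberPrasad2015, Prop. A.8.10(1)]. -/
theorem id_of_trivial (Y : Over S) : IsFixedPointScheme (1 : G →* Aut Y) (𝟙 Y) where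
  toIsFixedPointObject := IsFixedPointObject.id_of_trivial Y
  isClosedImmersion := by rw [Over.id_left]; infer_instance

/-- Transport along an isomorphism of the source [cite: ConradGabberPrasad2015, Prop. A.8.10(1)]. -/
theorem of_iso (h : IsFixedPointScheme ρ j) {F' : Over S} (e : F' ≅ F) :
    IsFixedPointScheme ρ (e.hom ≫ j) where
  toIsFixedPointObject := h.toIsFixedPointObject.of_iso e
  isClosedImmersion := by
    have := h.isClosedImmersion
    rw [Over.comp_left]
    infer_instance

end IsFixedPointScheme

/-! ### Construction for finitely many automorphisms / finite groups -/

section Construction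

variable {Y : Over S}

/-- The common fixed locus of a list `l` of endomorphisms of `Y : Over S`, built by iterating
equalizers: for `f :: l` it is `Eq(ι_l ≫ f, ι_l) ⊆ E_l`, where `ι_l : E_l ⟶ Y` is the common fixed
locus of `l`.  Returns the object together with its structure map to `Y`
[cite: GortzWedhorn2020, (9.2) and Def./Prop. 9.7(ii)]. -/
noncomputable def commonFixedLocus : List (Y ⟶ Y) → (E : Over S) × (E ⟶ Y)
  | [] => ⟨Y, 𝟙 Y⟩
  | f :: l => ⟨equalizer ((commonFixedLocus l).2 ≫ f) (commonFixedLocus l).2,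
      equalizer.ι ((commonFixedLocus l).2 ≫ f) (commonFixedLocus l).2 ≫ (commonFixedLocus l).2⟩

/-- [cite: GortzWedhorn2020, (9.2)] -/
@[simp]
theorem commonFixedLocus_nil : commonFixedLocus ([] : List (Y ⟶ Y)) = ⟨Y, 𝟙 Y⟩ := rfl

/-- [cite: GortzWedhorn2020, (9.2)] -/
theorem commonFixedLocus_cons (f : Y ⟶ Y) (l : List (Y ⟶ Y)) :
    commonFixedLocus (f :: l) = ⟨equalizer ((commonFixedLocus l).2 ≫ f) (commonFixedLocus l).2,
      equalizer.ι ((commonFixedLocus l).2 ≫ f) (commonFixedLocus l).2 ≫ (commonFixedLocus l).2⟩ :=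
  rfl

/-- The structure map of the common fixed locus is fixed by every member of the list
[cite: GortzWedhorn2020, (9.2)]. -/
theorem commonFixedLocus_snd_comp (l : List (Y ⟶ Y)) {f : Y ⟶ Y} (hf : f ∈ l) :
    (commonFixedLocus l).2 ≫ f = (commonFixedLocus l).2 := by
  induction l with
  | nil => simp at hf
  | cons f' l ih =>
    rw [commonFixedLocus_cons]
    dsimp only
    rcases List.mem_cons.mp hf with rfl | hf'
    · rw [Category.assoc]
      exact equalizer.condition _ _
    · rw [Category.assoc, ih hf']

/-- Universal property of the common fixed locus: a `T`-point of `Y` fixed by every member of the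
list factors uniquely through it [cite: GortzWedhorn2020, (9.2)]. -/
theorem commonFixedLocus_existsUnique (l : List (Y ⟶ Y)) {T : Over S} (y : T ⟶ Y)
    (hy : ∀ f ∈ l, y ≫ f = y) : ∃! t : T ⟶ (commonFixedLocus l).1, t ≫ (commonFixedLocus l).2 = y := by
  induction l with
  | nil => exact ⟨y, Category.comp_id y, fun t ht => by simpa using ht⟩
  | cons f l ih =>
    obtain ⟨t, ht, htu⟩ := ih (fun f' hf' => hy f' (List.mem_cons_of_mem f hf'))
    have hyf : y ≫ f = y := hy f List.mem_cons_self
    rw [commonFixedLocus_cons]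
    dsimp only
    have heq : t ≫ ((commonFixedLocus l).2 ≫ f) = t ≫ (commonFixedLocus l).2 := by
      rw [← Category.assoc, ht, hyf]
    refine ⟨equalizer.lift t heq, ?_, fun t' ht' => ?_⟩
    · dsimp only
      rw [← Category.assoc, equalizer.lift_ι, ht]
    · dsimp only at ht'
      apply equalizer.hom_ext
      rw [equalizer.lift_ι]
      exact htu _ (by dsimp only; rw [Category.assoc, ht'])

/-- For `Y → S` separated the common fixed locus is a CLOSED subscheme of `Y`: each equalizer of
two `S`-morphisms into the separated `S`-scheme `Y` is closed
[cite: GortzWedhorn2020, Def./Prop. 9.7(ii)] (Mathlib `isClosedImmersion_equalizer_ι_left`),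
and closed immersions compose. -/
theorem isClosedImmersion_commonFixedLocus [IsSeparated Y.hom] (l : List (Y ⟶ Y)) :
    IsClosedImmersion (commonFixedLocus l).2.left := by
  induction l with
  | nil => rw [commonFixedLocus_nil]; dsimp only; rw [Over.id_left]; infer_instance
  | cons f l ih =>
    rw [commonFixedLocus_cons]
    dsimp only
    rw [Over.comp_left]
    infer_instance

variable [Finite G]

/-- The list of the automorphisms `ρ g`, `g ∈ G` (finite `G`; some enumeration)
[cite: ConradGabberPrasad2015, Prop. A.8.10(1)]. -/
noncomputable def actionList (ρ : G →* Aut Y) : List (Y ⟶ Y) :=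
  haveI := Fintype.ofFinite G
  (Finset.univ : Finset G).toList.map fun g => (ρ g).hom

/-- [cite: ConradGabberPrasad2015, Prop. A.8.10(1)] -/
theorem mem_actionList_iff (ρ : G →* Aut Y) {f : Y ⟶ Y} :
    f ∈ actionList ρ ↔ ∃ g : G, (ρ g).hom = f := by
  simp [actionList]

/-- [cite: ConradGabberPrasad2015, Prop. A.8.10(1)] -/
theorem hom_mem_actionList (ρ : G →* Aut Y) (g : G) : (ρ g).hom ∈ actionList ρ :=
  (mem_actionList_iff ρ).mpr ⟨g, rfl⟩

/-- **The fixed-point scheme `Y^G` of a finite group action** on `Y : Over S`: the common fixed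
locus of the automorphisms `ρ g` (iterated equalizers `Eq(𝟙, ρ g)`), i.e. the construction of
[cite: ConradGabberPrasad2015, Prop. A.8.10(1)] in the finite-group case.
TODO(general form): actions of affine flat `k`-group schemes `H` with `k'[H]` projective
(loc. cit.), via the closed subscheme `α⁻¹(Δ) ⊆ H × Y` and its ideal of coefficients. -/
noncomputable def fixedPointScheme (ρ : G →* Aut Y) : Over S :=
  (commonFixedLocus (actionList ρ)).1

/-- The structure map `Y^G ⟶ Y` of the fixed-point scheme of a finite group action
[cite: ConradGabberPrasad2015, Prop. A.8.10(1)]. -/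
noncomputable def fixedPointScheme.ι (ρ : G →* Aut Y) : fixedPointScheme ρ ⟶ Y :=
  (commonFixedLocus (actionList ρ)).2

/-- `Y^G ⟶ Y` is fixed by the action [cite: ConradGabberPrasad2015, Prop. A.8.10(1)]. -/
@[simp]
theorem fixedPointScheme.ι_comp_hom (ρ : G →* Aut Y) (g : G) :
    fixedPointScheme.ι ρ ≫ (ρ g).hom = fixedPointScheme.ι ρ :=
  commonFixedLocus_snd_comp _ (hom_mem_actionList ρ g)

/-- The construction `fixedPointScheme ρ` represents the invariant-locus functor (no
separatedness needed for this part) [cite: ConradGabberPrasad2015, Prop. A.8.10(1)]. -/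
theorem fixedPointScheme.isFixedPointObject (ρ : G →* Aut Y) :
    IsFixedPointObject ρ (fixedPointScheme.ι ρ) where
  comp_hom := fixedPointScheme.ι_comp_hom ρ
  existsUnique_fac T y hy :=
    commonFixedLocus_existsUnique _ y fun f hf => by
      obtain ⟨g, rfl⟩ := (mem_actionList_iff ρ).mp hf
      exact hy g

/-- **Representability of the invariant locus (Conrad–Gabber–Prasad A.8.10(1), finite groups).**
For a finite group `G` acting by `S`-automorphisms on a separated `S`-scheme `Y`, the
invariant-locus functor is represented by the closed subscheme `fixedPointScheme ρ ⊆ Y`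
[cite: ConradGabberPrasad2015, Prop. A.8.10(1)]. -/
theorem fixedPointScheme.isFixedPointScheme [IsSeparated Y.hom] (ρ : G →* Aut Y) :
    IsFixedPointScheme ρ (fixedPointScheme.ι ρ) where
  toIsFixedPointObject := fixedPointScheme.isFixedPointObject ρ
  isClosedImmersion := isClosedImmersion_commonFixedLocus _

/-- Existence form of [cite: ConradGabberPrasad2015, Prop. A.8.10(1)] (finite groups). -/
theorem exists_isFixedPointScheme [IsSeparated Y.hom] (ρ : G →* Aut Y) :
    ∃ (F : Over S) (j : F ⟶ Y), IsFixedPointScheme ρ j :=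
  ⟨_, _, fixedPointScheme.isFixedPointScheme ρ⟩

/-- Any fixed-point scheme of a finite group action on a separated `S`-scheme is isomorphic,
over `Y`, to the construction `fixedPointScheme ρ` [cite: ConradGabberPrasad2015, Prop. A.8.10(1)]. -/
theorem IsFixedPointScheme.iso_fixedPointScheme_hom_comp {F : Over S} {ρ : G →* Aut Y} {j : F ⟶ Y}
    (h : IsFixedPointScheme ρ j) :
    (h.toIsFixedPointObject.iso (fixedPointScheme.isFixedPointObject ρ)).hom ≫
      fixedPointScheme.ι ρ = j :=
  IsFixedPointObject.iso_hom_comp _ _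

end Construction

end Scheme

/-! ## Equivariant smooth proper families (D2) -/

section Family

variable {𝒳 B : Scheme.{u}} {G : Type*} [Group G]

/-- An action `ρ : G →* Aut 𝒳` by automorphisms commuting with `π : 𝒳 ⟶ B` is an action by
`B`-automorphisms of the `B`-scheme `Over.mk π` [cite: HassettTschinkel2013, §2 Thm. 2.1]. -/
noncomputable def overAction (π : 𝒳 ⟶ B) (ρ : G →* Aut 𝒳) (hρ : ∀ g : G, (ρ g).hom ≫ π = π) :
    G →* Aut (Over.mk π) where
  toFun g := Over.isoMk (ρ g) (hρ g)
  map_one' := by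
    apply Iso.ext
    ext
    simp only [map_one, Over.isoMk_hom_left]
    rfl
  map_mul' g g' := by
    apply Iso.ext
    ext
    simp only [map_mul, Aut.Aut_mul_def, Over.isoMk_hom_left, Iso.trans_hom, Over.comp_left]
    rfl

/-- [cite: HassettTschinkel2013, §2 Thm. 2.1] -/
@[simp]
theorem overAction_apply_hom_left (π : 𝒳 ⟶ B) (ρ : G →* Aut 𝒳)
    (hρ : ∀ g : G, (ρ g).hom ≫ π = π) (g : G) :
    ((overAction π ρ hρ) g).hom.left = (ρ g).hom := rfl

/-- [cite: HassettTschinkel2013, §2 Thm. 2.1] -/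
@[simp]
theorem overAction_apply_inv_left (π : 𝒳 ⟶ B) (ρ : G →* Aut 𝒳)
    (hρ : ∀ g : G, (ρ g).hom ≫ π = π) (g : G) :
    ((overAction π ρ hρ) g).inv.left = (ρ g).inv := rfl

/-- **Equivariant smooth proper family.**  A morphism `π : 𝒳 ⟶ B` together with an action
`ρ : G →* Aut 𝒳` is an equivariant smooth proper family when `π` is SMOOTH (Mathlib `Smooth`)
and PROPER (Mathlib `IsProper`) and `G` acts by `B`-automorphisms, `ρ g ≫ π = π`.  This is the
algebraic form of the proper families `π : 𝒳 → B` of manifolds with a group acting fibrewise of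
[cite: HassettTschinkel2013, §2 Thm. 2.1]; finiteness of `G`, connectedness of `B` and
invertibility of `|G|` on `B` are hypotheses of the uses, and the EXISTENCE of such a family
through a given fibre is never asserted by this predicate. -/
structure IsEquivariantSmoothProperFamily (π : 𝒳 ⟶ B) (ρ : G →* Aut 𝒳) : Prop where
  /-- `π` is smooth. -/
  smooth : Smooth π
  /-- `π` is proper. -/
  isProper : IsProper π
  /-- the action is by `B`-automorphisms. -/
  hom_comp : ∀ g : G, (ρ g).hom ≫ π = π

namespace IsEquivariantSmoothProperFamily

variable {π : 𝒳 ⟶ B} {ρ : G →* Aut 𝒳}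

/-- [cite: HassettTschinkel2013, §2 Thm. 2.1] -/
theorem isSeparated (h : IsEquivariantSmoothProperFamily π ρ) : IsSeparated π :=
  h.isProper.toIsSeparated

/-- [cite: HassettTschinkel2013, §2 Thm. 2.1] -/
theorem locallyOfFinitePresentation (h : IsEquivariantSmoothProperFamily π ρ) :
    LocallyOfFinitePresentation π :=
  have := h.smooth
  inferInstance

/-- [cite: HassettTschinkel2013, §2 Thm. 2.1] -/
theorem flat (h : IsEquivariantSmoothProperFamily π ρ) : Flat π :=
  have := h.smooth
  inferInstance

/-- [cite: HassettTschinkel2013, §2 Thm. 2.1] -/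
theorem inv_comp (h : IsEquivariantSmoothProperFamily π ρ) (g : G) : (ρ g).inv ≫ π = π := by
  rw [Iso.inv_comp_eq, h.hom_comp]

/-- The action of an equivariant family as an action by automorphisms of the `B`-scheme
`Over.mk π` [cite: HassettTschinkel2013, §2 Thm. 2.1]. -/
noncomputable def action (h : IsEquivariantSmoothProperFamily π ρ) : G →* Aut (Over.mk π) :=
  overAction π ρ h.hom_comp

/-- [cite: HassettTschinkel2013, §2 Thm. 2.1] -/
@[simp]
theorem action_apply_hom_left (h : IsEquivariantSmoothProperFamily π ρ) (g : G) :
    (h.action g).hom.left = (ρ g).hom := rfl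

variable [Finite G]

/-- The RELATIVE fixed-point scheme `𝒳^G → B` of an equivariant smooth proper family with finite
group (the construction of [cite: ConradGabberPrasad2015, Prop. A.8.10(1)] over the base `B`). -/
noncomputable def fixedPointScheme (h : IsEquivariantSmoothProperFamily π ρ) : Over B :=
  GroupActions.fixedPointScheme h.action

/-- The closed immersion `𝒳^G ⟶ 𝒳` over `B` [cite: ConradGabberPrasad2015, Prop. A.8.10(1)]. -/
noncomputable def fixedPointSchemeι (h : IsEquivariantSmoothProperFamily π ρ) :
    h.fixedPointScheme ⟶ Over.mk π :=
  GroupActions.fixedPointScheme.ι h.action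

/-- `𝒳^G ⟶ 𝒳` IS the fixed-point scheme of the action over `B` (closed, invariant, universal),
since a proper `π` is separated [cite: ConradGabberPrasad2015, Prop. A.8.10(1)]. -/
theorem isFixedPointScheme (h : IsEquivariantSmoothProperFamily π ρ) :
    IsFixedPointScheme h.action h.fixedPointSchemeι :=
  have : IsSeparated (Over.mk π).hom := h.isSeparated
  GroupActions.fixedPointScheme.isFixedPointScheme _

/-- `𝒳^G → B` is proper [cite: GortzWedhorn2020, Rem. 9.11]. -/
theorem isProper_fixedPointScheme (h : IsEquivariantSmoothProperFamily π ρ) :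
    IsProper h.fixedPointScheme.hom :=
  have : IsProper (Over.mk π).hom := h.isProper
  h.isFixedPointScheme.isProper

/-- `𝒳^G → B` is separated [cite: GortzWedhorn2020, Def./Prop. 9.7]. -/
theorem isSeparated_fixedPointScheme (h : IsEquivariantSmoothProperFamily π ρ) :
    IsSeparated h.fixedPointScheme.hom :=
  have : IsSeparated (Over.mk π).hom := h.isSeparated
  h.isFixedPointScheme.isSeparated

/-- The fibre of `𝒳^G → B` at `b ∈ B` is the fixed-point scheme of the induced action on the
fibre `𝒳_b` [cite: ConradGabberPrasad2015, Prop. A.8.10(1)]. -/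
theorem isFixedPointScheme_fibre (h : IsEquivariantSmoothProperFamily π ρ) (b : B) :
    IsFixedPointScheme (((Over.pullback (B.fromSpecResidueField b)).mapAut (Over.mk π)).comp h.action)
      ((Over.pullback (B.fromSpecResidueField b)).map h.fixedPointSchemeι) :=
  h.isFixedPointScheme.fibre b

omit [Finite G] in
/-- Any smooth proper morphism with the TRIVIAL action is an equivariant smooth proper family
(non-vacuity of the interface) [cite: HassettTschinkel2013, §2 Thm. 2.1]. -/
theorem of_trivial (π : 𝒳 ⟶ B) [Smooth π] [IsProper π] :
    IsEquivariantSmoothProperFamily π (1 : G →* Aut 𝒳) where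
  smooth := ‹_›
  isProper := ‹_›
  hom_comp g := by rw [MonoidHom.one_apply]; exact Category.id_comp π

omit [Finite G] in
/-- **Base change of an equivariant smooth proper family.**  For `f : B' ⟶ B` the pulled-back
family `𝒳 ×_B B' → B'` (`pullback.snd π f`) with the pulled-back action
`g ↦ (Over.pullback f).mapIso (ρ g)` is again an equivariant smooth proper family (smoothness and
properness are stable under base change) [cite: HassettTschinkel2013, §2 Thm. 2.1]. -/
theorem baseChange (h : IsEquivariantSmoothProperFamily π ρ) {B' : Scheme.{u}} (f : B' ⟶ B) :
    IsEquivariantSmoothProperFamily (pullback.snd π f)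
      (((Over.forget B').mapAut ((Over.pullback f).obj (Over.mk π))).comp
        (((Over.pullback f).mapAut (Over.mk π)).comp h.action)) where
  smooth := by have := h.smooth; infer_instance
  isProper := by have := h.isProper; infer_instance
  hom_comp g := Over.w ((Over.pullback f).map (h.action g).hom)

end IsEquivariantSmoothProperFamily

/-- `|G|` is invertible on `B`: the order of the finite group `G` is a unit in `Γ(B, 𝒪_B)` — the
hypothesis under which a constant finite group has linearly reductive fibres, as required in
[cite: ConradGabberPrasad2015, Prop. A.8.10(2)] (a hypothesis of the uses of D2, not a field). -/
def OrderInvertibleOn (G : Type*) [Finite G] (B : Scheme.{u}) : Prop :=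
  IsUnit ((Nat.card G : ℕ) : Γ(B, ⊤))

/-- [cite: ConradGabberPrasad2015, Prop. A.8.10(2)] -/
theorem orderInvertibleOn_iff (G : Type*) [Finite G] (B : Scheme.{u}) :
    OrderInvertibleOn G B ↔ IsUnit ((Nat.card G : ℕ) : Γ(B, ⊤)) := Iff.rfl

/-- The trivial group has invertible order on every scheme
[cite: ConradGabberPrasad2015, Prop. A.8.10(2)]. -/
theorem orderInvertibleOn_of_subsingleton (G : Type*) [Finite G] [Subsingleton G] [Nonempty G]
    (B : Scheme.{u}) : OrderInvertibleOn G B := by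
  rw [orderInvertibleOn_iff, Nat.card_eq_one_iff_unique.mpr ⟨‹_›, ‹_›⟩, Nat.cast_one]
  exact isUnit_one
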